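import Mathlib
import Summits.Ventures.PercRepro2.TypedPocketABSupport
import Summits.Ventures.PercRepro2.TypedSepThreeTheorem
import Summits.Ventures.PercRepro2.RootCutTheorem

/-!
# The `{a₃, b}`-pocket class, III: row 2′TRI on the class (blind cell PercRepro2, p3 g6,
2026-08-25; `proofs/P3-BRIDGE.md` §11.21)

On a pocket split (`SplitP`: the doors `a₃, b` separate `o` from both roots) the kernel `K₃` is a
side kernel (`K3_eq_sideP`), its doubly symmetrised form is `dsymP` on the side states
(`symB_symA_sideΦP`), which is pointwise NONNEGATIVE (`dsymP_nonneg`); with the identity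
`36 · typedCount (sideKernel Φ) = typedCount (sideKernel (symB (symA Φ)))` and the pointwise
nonnegativity of typed counts (`typedCount_side_nonneg`) **every typed base is nonnegative**:
`typedCount_nonneg_of_splitP`, the `z ≡ false` class `HasPocketAB` and
`typedCount_nonneg_of_hasPocketAB`.  The mechanism is the one of the typed (SEP-3) zero — an
identity across the separator followed by a pointwise `decide` of the `S₃ × S₃`-symmetrised
kernel — now giving a NONNEGATIVITY class (the kernel is not identically zero there: max 16).
Own work; standard axioms.
-/

namespace Summit.Ventures.PercRepro2

open UnionCluster

namespace CovForm

namespace PocketAB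

open OneTyped TypedA3 Untouched TypedFactor Separated RootBridge SepThree

section Nonneg

variable {E : Type*} [Fintype E] [DecidableEq E] {R : Type*} [Field R] [LinearOrder R]
  [IsStrictOrderedRing R]

/-- **A side kernel whose doubly symmetrised form is pointwise nonnegative has nonnegative typed
count.** -/
theorem typedCount_side_nonneg (F : Finset E) {A B : Finset E} (hA : A ⊆ F) (hB : B ⊆ F)
    (hAB : Disjoint A B) (z : Config E) (τ : E → ℕ)
    (Φ : Config E → Config E → Config E → Config E → Config E → Config E → R)
    (h : ∀ xa ya wa xb yb wb, 0 ≤ symB (symA Φ) xa ya wa xb yb wb) :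
    0 ≤ typedCount F z τ (sideKernel A B z Φ) := by
  have h36 := thirtysix_mul_typedCount_side F hA hB hAB z τ Φ
  have hz : 0 ≤ typedCount F z τ (sideKernel A B z (symB (symA Φ))) :=
    typedCount_nonneg_of_nonneg _ _ _ fun x y w => h _ _ _ _ _ _
  rw [← h36] at hz
  have h36' : (0 : R) < 36 := by norm_num
  exact nonneg_of_mul_nonneg_right (by simpa [mul_comm] using hz) h36'

end Nonneg

section Main

open Classical

variable {V : Type*} {E : Type*} [Fintype E] [DecidableEq E] {R : Type*} [Field R]
  [LinearOrder R] [IsStrictOrderedRing R]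
variable (ends : E → Sym2 V) (o a₁ a₂ a₃ b : V)

/-- The kernel on the side restrictions: `KB` on the glued side states. -/
noncomputable def sideΦP (WO WB : Set V) :
    Config E → Config E → Config E → Config E → Config E → Config E → R :=
  fun xa ya wa xb yb wb =>
    ((KB (gluedP (oStP ends o a₃ b WO xa) (bSt ends a₁ a₂ a₃ b WB xb))
      (gluedP (oStP ends o a₃ b WO ya) (bSt ends a₁ a₂ a₃ b WB yb))
      (gluedP (oStP ends o a₃ b WO wa) (bSt ends a₁ a₂ a₃ b WB wb)) : ℤ) : R)

variable {ends o a₁ a₂ a₃ b}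

omit [Fintype E] [LinearOrder R] [IsStrictOrderedRing R] in
/-- The o-side state only sees the o-side typed edges. -/
lemma oStP_restr (WO : Set V) {F : Finset E} {z x : Config E} (hx : ∀ e, e ∉ F → x e = z e) :
    oStP ends o a₃ b WO (restr (sideF ends WO F) z x) = oStP ends o a₃ b WO x := by
  unfold oStP
  rw [withinRestr_restr_eq ends WO hx]

omit [Fintype E] [LinearOrder R] [IsStrictOrderedRing R] in
/-- **`K₃` on the support of a pocket split is a side kernel.** -/
theorem K3_eq_sideP {WO WB : Set V} {F : Finset E} {z : Config E}
    (h : SplitP ends o a₁ a₂ a₃ b WO WB F z) {x y w : Config E}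
    (hx : ∀ e, e ∉ F → x e = z e) (hy : ∀ e, e ∉ F → y e = z e) (hw : ∀ e, e ∉ F → w e = z e) :
    (K3 ends o a₁ a₂ a₃ b x y w : R) =
      sideKernel (sideF ends WO F) (sideF ends WB F) z (sideΦP ends o a₁ a₂ a₃ b WO WB) x y w := by
  rw [K3_eq_KB, st_eq_pocketSt h (le_zF hx), st_eq_pocketSt h (le_zF hy),
    st_eq_pocketSt h (le_zF hw)]
  unfold sideKernel sideΦP
  rw [oStP_restr WO hx, oStP_restr WO hy, oStP_restr WO hw, bSt_restr WB hx, bSt_restr WB hy,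
    bSt_restr WB hw]

omit [Fintype E] [DecidableEq E] [LinearOrder R] [IsStrictOrderedRing R] in
/-- The doubly symmetrised side kernel is `dsymP` on the side states. -/
lemma symB_symA_sideΦP (WO WB : Set V) (xa ya wa xb yb wb : Config E) :
    symB (symA (sideΦP ends o a₁ a₂ a₃ b WO WB)) xa ya wa xb yb wb =
      ((dsymP (oStP ends o a₃ b WO xa) (oStP ends o a₃ b WO ya) (oStP ends o a₃ b WO wa)
        (bSt ends a₁ a₂ a₃ b WB xb) (bSt ends a₁ a₂ a₃ b WB yb)
        (bSt ends a₁ a₂ a₃ b WB wb) : ℤ) : R) := by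
  unfold symB symA sideΦP dsymP psiP
  push_cast
  ring

omit [Fintype E] [DecidableEq E] in
/-- The doubly symmetrised side kernel is nonnegative. -/
lemma symB_symA_sideΦP_nonneg (WO WB : Set V) (xa ya wa xb yb wb : Config E) :
    (0 : R) ≤ symB (symA (sideΦP (R := R) ends o a₁ a₂ a₃ b WO WB)) xa ya wa xb yb wb := by
  rw [symB_symA_sideΦP]
  exact_mod_cast dsymP_nonneg _ _ _ _ _ _ (validO_oStP WO xa) (validO_oStP WO ya)
    (validO_oStP WO wa) (validB_bSt WB xb) (validB_bSt WB yb) (validB_bSt WB wb)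

/-- **ROW 2′TRI ON THE `{a₃, b}`-POCKET CLASS**: on a pocket split — the doors `a₃, b` separate `o`
from both roots — every typed base of `K₃` is nonnegative, for every pinning `z` and every type
map. -/
theorem typedCount_nonneg_of_splitP {WO WB : Set V} (F : Finset E) (z : Config E) (τ : E → ℕ)
    (h : SplitP ends o a₁ a₂ a₃ b WO WB F z) :
    0 ≤ typedCount F z τ (K3 ends o a₁ a₂ a₃ b : Config E → Config E → Config E → R) := by
  set A := sideF ends WO F with hA
  set B := sideF ends WB F with hB
  have hAF : A ⊆ F := Finset.filter_subset _ _
  have hBF : B ⊆ F := Finset.filter_subset _ _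
  have hAB : Disjoint A B := by
    rw [Finset.disjoint_left]
    intro e heA heB
    simp only [hA, hB, sideF, Finset.mem_filter] at heA heB
    exact h.noloop e heA.1 ⟨heA.2, heB.2⟩
  have hker : typedCount F z τ (K3 ends o a₁ a₂ a₃ b : Config E → Config E → Config E → R) =
      typedCount F z τ (sideKernel A B z (sideΦP ends o a₁ a₂ a₃ b WO WB)) := by
    refine typedCount_congr_on_support F z τ fun x y w hc _ => ?_
    exact K3_eq_sideP h (fun e he => (hc e he).1) (fun e he => (hc e he).2.1)
      (fun e he => (hc e he).2.2)
  rw [hker]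
  exact typedCount_side_nonneg F hAF hBF hAB z τ _
    (fun xa ya wa xb yb wb => symB_symA_sideΦP_nonneg WO WB xa ya wa xb yb wb)

variable (ends o a₁ a₂ a₃ b)

/-- **The class of the typed graph `(V, F)`**: the doors `a₃, b` separate `o` from both roots
(`o`'s pocket hangs on `{a₃, b}`). -/
def HasPocketAB (F : Finset E) : Prop :=
  ∃ WO WB : Set V, SplitP ends o a₁ a₂ a₃ b WO WB F (fun _ => false)

/-- **Row 2′TRI on `HasPocketAB` at `z ≡ false`** — a nonnegativity conjunct for the residual
domain. -/
theorem typedCount_nonneg_of_hasPocketAB (F : Finset E) (τ : E → ℕ)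
    (h : HasPocketAB ends o a₁ a₂ a₃ b F) :
    0 ≤ typedCount F (fun _ => false) τ
      (K3 ends o a₁ a₂ a₃ b : Config E → Config E → Config E → R) := by
  obtain ⟨WO, WB, hs⟩ := h
  exact typedCount_nonneg_of_splitP F _ τ hs

end Main

end PocketAB

end CovForm

end Summit.Ventures.PercRepro2
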